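import Summits.CriticalPhenomena.SAWScalingLimit.Theorems.SAWDevelopingMapObservableToSLETypeLadderCarvedReductionTranslation
import Literature.Probability.Percolation.TriLoopWinding
import HarnessLib

/-!
# Pinning both gate rows from above with ONE lattice translation
# (piece (G1′) of stub 5a4′ `stub_carvedReduction_squeeze`)

Piece of stub 5a4′ `stub_carvedReduction_squeeze` (`TwoPieceAdmRestrictionLimit → MovingCarvingSqueeze`)
of the line `bridge-gate-renewal` (r9) of the crux `SAWDefectDecoherence.ObservableToSLER`
(stmt-CriticalPhenomena-14005; twin T2b′/T2b″ of stmt-CriticalPhenomena-10472), item (G1):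
THE PINNED FRAME.  Along the selected subsequence the rescaled gate up-faces `s_j c_{(q_j, 0)}`,
`s_j c_{(q'_j, 0)}` converge to the limit gate points `g₀`, `g₁`; the fixed two-piece flat domain
`M` of `MovingCarvingSqueeze` has its windows at the heights of its marked points, and the EXACT
ROWS of its inner family force the translated gate rows to sit STRICTLY ABOVE those heights at
every index (and to converge to them).  One translation `x_j : ℤ²` per index does it at BOTH ends
at once — no sign-subsequence is needed:

* `stub_carvedReduction_pinning` — there are lattice translations `x_j` (pure row shifts) and
  `τ ∈ ℂ` with `s_j • triEmbed x_j → τ`, `im (g₀ - τ) = 0`, translated gate up-faces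
  `s_j c_{(q_j - x_j, 0)} → g₀ - τ` and `s_j c_{(q'_j - x_j, 0)} → g₁ - τ`, and, FOR EVERY `j`,
  `0 < im (s_j c_{(q_j - x_j, 0)})` and `im (g₁ - τ) < im (s_j c_{(q'_j - x_j, 0)})` — the
  pinned gate rows sit strictly above the window heights `0 = im (g₀ - τ)` and `im (g₁ - τ)` of the
  marked points `g₀ - τ`, `g₁ - τ` of the pinned limit domain (row shift `q_j 1 - n_j` with
  `n_j = ⌈max 0 (e_j / K_j)⌉`, `K_j = s_j √3/2`,
  `e_j = im (g₁ - g₀) - (im s_j c_{q'_j} - im s_j c_{q_j}) → 0`).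

So the pinned domains `D - s_j • triEmbed x_j = (D - g₀) - ε_j` drift by `ε_j → 0` of the size
of the gate-height errors — in general `|ε_j| ≫ s_j` (cf. piece `…SqueezeJordanApprox`).
-/

noncomputable section

open scoped Topology
open Filter Set Metric
open Literature.Probability.LatticeModels (HexVertex hexGraph hexCenter triEmbed Site)
open Literature.Probability.RandomPlanarGeometry
open Literature.Probability.Percolation (hexCenter_re hexCenter_im)

namespace Summit.CriticalPhenomena.SAWScalingLimit.Theorems.ObservableToSLER.Squeeze

open Summit.CriticalPhenomena.SAWScalingLimit.Theorems.ObservableToSLE.TypeLadder (hexCenter_translate)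

/-- **Registered sub-goal `stub_carvedReduction_pinning`** (crux item stmt-CriticalPhenomena-14005,
stub 5a4′ `stub_carvedReduction_squeeze`, piece (G1′) PINNING BOTH GATE ROWS FROM ABOVE): see the
module docstring. -/
theorem stub_carvedReduction_pinning :
    ∀ (s : ℕ → ℝ) (q q' : ℕ → Site 2) (g₀ g₁ : ℂ), (∀ j, 0 < s j) → Tendsto s atTop (𝓝 0) →
      Tendsto (fun j => (s j : ℂ) * hexCenter ((q j, 0) : HexVertex)) atTop (𝓝 g₀) →
      Tendsto (fun j => (s j : ℂ) * hexCenter ((q' j, 0) : HexVertex)) atTop (𝓝 g₁) →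
      ∃ (x : ℕ → Site 2) (τ : ℂ),
        Tendsto (fun j => (s j : ℂ) * triEmbed (x j)) atTop (𝓝 τ) ∧ (g₀ - τ).im = 0 ∧
        Tendsto (fun j => (s j : ℂ) * hexCenter ((q j - x j, 0) : HexVertex)) atTop (𝓝 (g₀ - τ)) ∧
        Tendsto (fun j => (s j : ℂ) * hexCenter ((q' j - x j, 0) : HexVertex)) atTop (𝓝 (g₁ - τ)) ∧
        (∀ j, (0 : ℝ) < ((s j : ℂ) * hexCenter ((q j - x j, 0) : HexVertex)).im) ∧
        (∀ j, (g₁ - τ).im < ((s j : ℂ) * hexCenter ((q' j - x j, 0) : HexVertex)).im) := by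
  intro s q q' g₀ g₁ hs hs0 hq hq'
  -- heights
  set K : ℕ → ℝ := fun j => s j * (Real.sqrt 3 / 2) with hK
  have hK0 : ∀ j, 0 < K j := fun j => mul_pos (hs j) (by positivity)
  have him : ∀ (j : ℕ) (y : Site 2), ((s j : ℂ) * hexCenter ((y, 0) : HexVertex)).im =
      ((y 1 : ℝ) + 1 / 3) * K j := by
    intro j y
    rw [Complex.mul_im, Complex.ofReal_re, Complex.ofReal_im, zero_mul, add_zero, hexCenter_im]
    simp [hK]; ring
  -- the height error at the second gate and the row shift
  set e : ℕ → ℝ := fun j => (g₁ - g₀).im -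
    (((s j : ℂ) * hexCenter ((q' j, 0) : HexVertex)).im - ((s j : ℂ) * hexCenter ((q j, 0) : HexVertex)).im)
    with he
  set n : ℕ → ℕ := fun j => ⌈max 0 (e j / K j)⌉₊ with hn
  have hnK : ∀ j, max 0 (e j) ≤ (n j : ℝ) * K j := by
    intro j
    have h1 : max 0 (e j / K j) ≤ (n j : ℝ) := Nat.le_ceil _
    have h2 : max 0 (e j / K j) * K j = max 0 (e j) := by
      rw [max_mul_of_nonneg _ _ (hK0 j).le, zero_mul, div_mul_cancel₀ _ (hK0 j).ne']
    rw [← h2]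
    exact mul_le_mul_of_nonneg_right h1 (hK0 j).le
  have hnK' : ∀ j, (n j : ℝ) * K j ≤ max 0 (e j) + K j := by
    intro j
    have h1 : (n j : ℝ) < max 0 (e j / K j) + 1 := Nat.ceil_lt_add_one (le_max_left _ _)
    have h2 : max 0 (e j / K j) * K j = max 0 (e j) := by
      rw [max_mul_of_nonneg _ _ (hK0 j).le, zero_mul, div_mul_cancel₀ _ (hK0 j).ne']
    have := mul_le_mul_of_nonneg_right h1.le (hK0 j).le
    rw [add_mul, h2, one_mul] at this
    exact this
  -- the translations (row shift only)
  set x : ℕ → Site 2 := fun j => ![0, q j 1 - n j] with hx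
  have hx1 : ∀ j, (q j - x j) 1 = n j := fun j => by simp [hx]
  have hx1' : ∀ j, (q' j - x j) 1 = q' j 1 - q j 1 + n j := fun j => by simp [hx]; ring
  -- the pinned heights
  have himq : ∀ j, ((s j : ℂ) * hexCenter ((q j - x j, 0) : HexVertex)).im = ((n j : ℝ) + 1 / 3) * K j := by
    intro j; rw [him, hx1]; push_cast; ring
  have himq' : ∀ j, ((s j : ℂ) * hexCenter ((q' j - x j, 0) : HexVertex)).im =
      (((s j : ℂ) * hexCenter ((q' j, 0) : HexVertex)).im - ((s j : ℂ) * hexCenter ((q j, 0) : HexVertex)).im) +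
        ((n j : ℝ) + 1 / 3) * K j := by
    intro j; rw [him, him, him, hx1']; push_cast; ring
  -- `e j → 0`
  have he0 : Tendsto e atTop (𝓝 0) := by
    have h1 := (Complex.continuous_im.tendsto _).comp hq
    have h2 := (Complex.continuous_im.tendsto _).comp hq'
    have h3 := (h2.sub h1).const_sub (g₁ - g₀).im
    rw [Complex.sub_im, sub_self] at h3
    exact h3
  have hK0' : Tendsto K atTop (𝓝 0) := by
    have := hs0.mul_const (Real.sqrt 3 / 2)
    rw [zero_mul] at this
    exact this
  -- the pinned heights tend to `0`
  have hmax : Tendsto (fun j => max 0 (e j)) atTop (𝓝 0) := by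
    have h := (tendsto_const_nhds (x := (0 : ℝ)) (f := (atTop : Filter ℕ))).max he0
    rwa [max_self] at h
  have hpim : Tendsto (fun j => ((s j : ℂ) * hexCenter ((q j - x j, 0) : HexVertex)).im) atTop (𝓝 0) := by
    have hb : Tendsto (fun j => max 0 (e j) + K j + K j) atTop (𝓝 0) := by
      simpa using (hmax.add hK0').add hK0'
    refine squeeze_zero (fun j => ?_) (fun j => ?_) hb
    · rw [himq]; have := hK0 j; positivity
    · rw [himq]; have := hnK' j; have := hK0 j; nlinarith
  have himag : Tendsto (fun j => ((s j : ℂ) * hexCenter ((q j, 0) : HexVertex)).im) atTop (𝓝 g₀.im) :=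
    (Complex.continuous_im.tendsto _).comp hq
  -- the translation vectors: `s_j • triEmbed (x j) = (s_j (q_j 1 - n_j)) ζ` with
  -- `s_j (q_j 1 - n_j) (√3/2) = im (s_j c_{q_j}) - im (pinned)`
  have htri : ∀ j, (s j : ℂ) * triEmbed (x j) =
      (((2 / Real.sqrt 3) * (((s j : ℂ) * hexCenter ((q j, 0) : HexVertex)).im -
        ((s j : ℂ) * hexCenter ((q j - x j, 0) : HexVertex)).im) : ℝ) : ℂ) *
        Literature.Probability.LatticeModels.triZeta := by
    intro j
    rw [him, himq]
    have h3 : Real.sqrt 3 ≠ 0 := by positivity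
    have e1 : (2 / Real.sqrt 3) * (((q j 1 : ℝ) + 1 / 3) * K j - ((n j : ℝ) + 1 / 3) * K j) =
        s j * ((q j 1 : ℝ) - n j) := by
      simp only [hK]; field_simp; ring
    rw [e1]
    simp only [hx, triEmbed]
    push_cast
    simp
    ring
  set t : ℝ := (2 / Real.sqrt 3) * g₀.im with ht
  have hτ : Tendsto (fun j => (s j : ℂ) * triEmbed (x j)) atTop
      (𝓝 (((t : ℝ) : ℂ) * Literature.Probability.LatticeModels.triZeta)) := by
    have h1 : Tendsto (fun j => (2 / Real.sqrt 3) * (((s j : ℂ) * hexCenter ((q j, 0) : HexVertex)).im -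
        ((s j : ℂ) * hexCenter ((q j - x j, 0) : HexVertex)).im)) atTop (𝓝 t) := by
      have := (himag.sub hpim).const_mul (2 / Real.sqrt 3)
      rwa [sub_zero] at this
    have h2 := ((Complex.continuous_ofReal.tendsto _).comp h1).mul_const Literature.Probability.LatticeModels.triZeta
    exact h2.congr fun j => (htri j).symm
  set τ : ℂ := ((t : ℝ) : ℂ) * Literature.Probability.LatticeModels.triZeta with hτdef
  have hτim : (g₀ - τ).im = 0 := by
    rw [Complex.sub_im, hτdef, Complex.mul_im, Complex.ofReal_re, Complex.ofReal_im, zero_mul, add_zero,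
      Literature.Probability.LatticeModels.triZeta_im, ht]
    have h3 : Real.sqrt 3 ≠ 0 := by positivity
    field_simp
    ring
  -- the pinned up-faces
  have htrans : ∀ j, (s j : ℂ) * hexCenter ((q j - x j, 0) : HexVertex) =
      (s j : ℂ) * hexCenter ((q j, 0) : HexVertex) - (s j : ℂ) * triEmbed (x j) := by
    intro j
    have h := hexCenter_translate (x j) ((q j - x j, 0) : HexVertex)
    simp only [add_sub_cancel] at h
    rw [h]; ring
  have htrans' : ∀ j, (s j : ℂ) * hexCenter ((q' j - x j, 0) : HexVertex) =
      (s j : ℂ) * hexCenter ((q' j, 0) : HexVertex) - (s j : ℂ) * triEmbed (x j) := by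
    intro j
    have h := hexCenter_translate (x j) ((q' j - x j, 0) : HexVertex)
    simp only [add_sub_cancel] at h
    rw [h]; ring
  refine ⟨x, τ, hτ, hτim, (hq.sub hτ).congr fun j => (htrans j).symm,
    (hq'.sub hτ).congr fun j => (htrans' j).symm, fun j => ?_, fun j => ?_⟩
  · rw [himq]; have := hK0 j; positivity
  · have hg : (g₁ - τ).im = (g₁ - g₀).im := by
      have : g₁ - τ = (g₁ - g₀) + (g₀ - τ) := by ring
      rw [this, Complex.add_im, hτim, add_zero]
    rw [hg, himq']
    have h1 := hnK j
    have h2 : e j ≤ max 0 (e j) := le_max_right _ _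
    have h3 : e j = (g₁ - g₀).im - (((s j : ℂ) * hexCenter ((q' j, 0) : HexVertex)).im -
        ((s j : ℂ) * hexCenter ((q j, 0) : HexVertex)).im) := rfl
    have := hK0 j
    nlinarith

end Summit.CriticalPhenomena.SAWScalingLimit.Theorems.ObservableToSLER.Squeeze

end
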